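import Literature.AlgebraicGeometry.Resolution.ArithmeticalThreefoldsDescentHeadQuotientLU
import Literature.AlgebraicGeometry.Resolution.LUCompleteDimLETwo
import Literature.AlgebraicGeometry.Resolution.EmbeddedResolutionExcellentSurfacesCor15
import Literature.AlgebraicGeometry.Resolution.ProjectiveSpaceCodimTwoReembedding
import Literature.AlgebraicGeometry.Resolution.ArithmeticalThreefoldsAlgebraization
import Literature.AlgebraicGeometry.Resolution.SmoothImpliesRegular
import HarnessLib

/-!
# Cossart–Piltant 2019, Prop. 4.8 (`(LU) for complete local domains of dimension three ⇒ (LU)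
# in dimension three over every field`) — the named fact `CossartPiltant2019LU3OfComplete`
# DERIVED from Cossart–Jannsen–Saito Thm. 1.4 (`B = ∅`)

Topic: `Literature/AlgebraicGeometry/Resolution` (proofs only; no new notions, no new named
facts). `ArithmeticalThreefolds.lean` vendors Cossart–Piltant's journal Prop. 4.8 (= arXiv v1
Prop. 4.6, pp. 52–53: "Assume that (LU) holds for every complete local domain of dimension three.
Then theorem 1.1 holds", in its (LU) form) as the named implication
`CossartPiltant2019LU3OfComplete : CossartPiltant2019LUComplete3 → CossartPiltant2019LU3`;
`ArithmeticalThreefoldsDescentHead.lean` reduced it to resolution of excellent surfaces plus a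
named geometric head (`CossartPiltant2019_descentHead`). With the head proved at rank one
(`exists_adjoin_isRegularLocalRing_rankOne_of_quotientLU`, `localUniformization3_of_quotientLU`)
and (LU) for complete local domains of dimension `≤ 2` proved
(`cpLocalUniformization_of_isAdicComplete_of_ringKrullDim_le_two`), the implication now follows
from the EMBEDDED surface theorem alone:

* `cpLocalUniformization_quotient_completion_of_luComplete3` — every local domain that is a
  homomorphic image of `B̂_𝔭` (`dim B_𝔭 = 3`) has (LU), given `CossartPiltant2019LUComplete3`
  (dimension `3`) and CJS Thm. 1.4 (dimension `≤ 2`);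
* `CossartPiltant2019LU3OfComplete.of_embedded :
  CossartJannsenSaito2020Embedded.{0} → CossartPiltant2019LU3OfComplete.{0}`.

## Sources

* V. Cossart, O. Piltant, J. Algebra 529 (2019) 268–535 = arXiv:1412.0868, §4.1 and Prop. 4.8
  with Lemma 4.7 (arXiv v1: Prop. 4.6, pp. 52–53). [CossartPiltant2019]
* V. Cossart, U. Jannsen, S. Saito, LNM 2270 (2020), Thm. 1.2, Thm. 1.4, Cor. 1.5.
  [CossartJannsenSaito2020]
* J. Novacoski, M. Spivakovsky, arXiv:1204.4751v1, Thm. 1.1, Cor. 2.17, §3.1.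
  [NovacoskiSpivakovsky2014]
-/

noncomputable section

namespace Literature.AlgebraicGeometry.Resolution

universe u

open IsLocalRing Function

/-- **(LU) for every homomorphic image of `B̂_𝔭`** (`B` a domain of finite type over a field,
`dim B_𝔭 = 3`) from (LU) for complete local domains of dimension `3`
(`CossartPiltant2019LUComplete3`) and CJS Thm. 1.4 (dimension `≤ 2`,
`cpLocalUniformization_of_isAdicComplete_of_ringKrullDim_le_two`): such an image is a complete
Noetherian local domain of dimension `≤ 3`.
[cite: CossartPiltant2019, proof of Prop. 4.8 (arXiv v1: Prop. 4.6, pp. 52–53)]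
[cite: CossartJannsenSaito2020, Thm. 1.4] -/
theorem cpLocalUniformization_quotient_completion_of_luComplete3
    (hCJSE : CossartJannsenSaito2020Embedded.{u}) (hc : CossartPiltant2019LUComplete3.{u})
    {k B : Type u} [Field k] [CommRing B] [IsDomain B] [Algebra k B] [Algebra.FiniteType k B]
    (𝔭 : Ideal B) [𝔭.IsPrime] (hdim : ringKrullDim (Localization.AtPrime 𝔭) = 3)
    (R : Type u) [CommRing R] [IsDomain R] [IsLocalRing R]
    (π : AdicCompletion (maximalIdeal (Localization.AtPrime 𝔭)) (Localization.AtPrime 𝔭) →+* R)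
    (hπ : Function.Surjective π) : CPLocalUniformization R := by
  set A := Localization.AtPrime 𝔭 with hAdef
  haveI : IsNoetherianRing B := Algebra.FiniteType.isNoetherianRing k B
  haveI : IsNoetherianRing A := IsLocalization.isNoetherianRing 𝔭.primeCompl _ inferInstance
  set Ah := AdicCompletion (maximalIdeal A) A with hAhdef
  haveI : IsNoetherianRing Ah := isNoetherianRing_adicCompletion_maximalIdeal A
  haveI : IsNoetherianRing R := isNoetherianRing_of_surjective Ah R π hπ
  haveI : IsAdicComplete (maximalIdeal R) R := isAdicComplete_of_surjective π hπ
  have hle : ringKrullDim R ≤ 3 := by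
    calc ringKrullDim R ≤ ringKrullDim Ah := ringKrullDim_le_of_surjective π hπ
      _ = ringKrullDim A := ringKrullDim_adicCompletion A
      _ = 3 := hdim
  obtain ⟨n, hn⟩ := exists_ringKrullDim_eq_natCast R
  rw [hn] at hle
  have hn3 : n ≤ 3 := by exact_mod_cast hle
  rcases Nat.lt_or_ge n 3 with hlt | hge
  · refine cpLocalUniformization_of_isAdicComplete_of_ringKrullDim_le_two hCJSE R ?_
    rw [hn]; exact_mod_cast (Nat.lt_succ_iff.mp hlt)
  · refine hc R ?_
    rw [hn]; exact_mod_cast le_antisymm hn3 hge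

/-- **Cossart–Piltant 2019, journal Prop. 4.8 — the named fact `CossartPiltant2019LU3OfComplete`
— from Cossart–Jannsen–Saito Thm. 1.4 (`B = ∅`) alone**: (LU) for complete Noetherian local
domains of dimension three implies `LocalUniformization3 k` for every field `k`. Proof: surface
resolution over `k` (`cossartJannsenSaito2020_of_embedded`) and embedded resolution in the
Cor. 1.5 form (`CossartJannsenSaito2020Embedded.cor15`) feed `localUniformization3_of_quotientLU`
(the geometric head at rank one, Novacoski–Spivakovsky in transcendence degree `≤ 3`), whose
input on the quotients of `B̂_𝔭` is `cpLocalUniformization_quotient_completion_of_luComplete3`.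
[cite: CossartPiltant2019, §4.1 and Prop. 4.8 with Lemma 4.7 (arXiv v1: Prop. 4.6, pp. 52–53)]
[cite: CossartJannsenSaito2020, Thm. 1.2, Thm. 1.4, Cor. 1.5] [cite: NovacoskiSpivakovsky2014, Thm. 1.1] -/
theorem CossartPiltant2019LU3OfComplete.of_embedded (hCJSE : CossartJannsenSaito2020Embedded.{0}) :
    CossartPiltant2019LU3OfComplete.{0} := fun hc k _ =>
  localUniformization3_of_quotientLU (cossartJannsenSaito2020_of_embedded hCJSE) k
    (CossartJannsenSaito2020Embedded.cor15 hCJSE)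
    fun _ _ _ _ _ 𝔭 _ _ h2 R _ _ _ π hπ =>
      cpLocalUniformization_quotient_completion_of_luComplete3 (k := k) hCJSE hc 𝔭 h2 R π hπ

end Literature.AlgebraicGeometry.Resolution

end
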